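import Mathlib
import HarnessLib
import HarnessLib.Audit
import Summits.AtomisticToContinuum.Statement

/-!
Route: InformationPercolation

CLOSED (retired) 2026-08-15T13:43:26Z by operator:999:1257524 — reason: not-a-thesis: assembly does not conclude the sub-problem Statement — note: D-0027 §2.1 audit (human 2026-08-15: routes that do not decide the summit are removed): the assembly concludes `Literature.MathematicalPhysics.KineticTheory.HydrodynamicLimit`, not the sub-problem statement; a NEW conforming route may be opened from the same idea (generated `closes : … → _root_.Hydr. The file is kept as the record of this route; refuted decls are indexed as negative knowledge (`ledger negatives`).

# Route InformationPercolation — information percolation on the collision DAG — subcritical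
χ²-dilution of shared ancestry (2λ₂² < 1) plus conditional kick isotropy give molecular chaos at
contact at fixed density

It suffices to show X = ContactChaos ∧ (CollisionRate ∧ LocalSecondLaw ∧ DensityCap), where
ContactChaos (= stmt-AtomisticToContinuum-3987,
SHARED with route CollisionMeasureChaos) is averaged molecular chaos of the empirical collision
measure at FIXED reduced density σ, and the
bracket is that route's typed closure (rate = Enskog contact value, local second law, no
overcompression; re-attached here as support).
This route is a MECHANISM for ContactChaos, realising card information-percolation-collision-dag:
treat the backward collision DAG of the
hard-sphere flow as a noisy network — node noise = the impact parameter of each collision,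
near-uniform given the coarse past
(crux KickIsotropyInfo, informal, filed after open) — and obtain chaos not from DISJOINTNESS of
collision histories (void after the local
branching horizon ≍ 2·log₂(1/φ) mean free times, hence for the whole Euler evolution at fixed
density) but from subcritical DILUTION of
shared information along lineages: the one-particle hard-sphere jump operator K contracts
χ²-information by λ₂² per collision while
ancestries branch by 2, so pair correlations at contact are summable over all depths iff 2λ₂² < 1
(crux SpectralContraction, typed;
conjecturally λ₂² = 1/4), uniformly over the ≍ N^{1/3} collision generations of an Euler time; the
O(φ) ring sector that dilution does
not remove must cancel against local equilibrium (crux RingSectorNeutrality, informal, filed after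
open). Conserved means sit exactly AT
criticality (2λ₁ = 1, λ₁ = 1/2 by momentum conservation + isotropy) — "Euler lives on the
Kesten–Stigum line" — and so does relative
ENTROPY (fast particles transmit exactly half: support EntropyHalving), which is why the engine runs
in χ² and not in KL currency.
Lean: `ContactChaos ∧ CollisionRate ∧ LocalSecondLaw ∧ DensityCap`

## Assembly
Identical to the assembly of route CollisionMeasureChaos (stmt-AtomisticToContinuum-3994, shared by
signature): ContactChaos (product structure of
the limit collision kernel) + CollisionRate (Enskog rate, hence p = hsPressure with Maxwellian
closure by Boltzmann's balance rigidity) +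
LocalSecondLaw + DensityCap ⇒ the limit pair (empirical measure, empirical collision measure) is a
Maxwellian-closed dissipative solution of the
complete hs-Euler system with the classical data ⇒ Březina–Feireisl relative energy ⇒ it is the
classical solution on [0,T) ⇒ convergence in
probability of the fields ⇒ HydrodynamicLimitFor σ ⇒ the conjunct (hydrodynamicLimit_of_forall).
This route adds nothing to that chain and
everything to its first arrow: the engine items (KickIsotropyInfo, SpectralContraction,
RingSectorNeutrality; EntropyHalving) are HOW ContactChaos
is to be proved, and sit beside it at layer 1 (their glue, the percolation theorem on the collision
DAG, is layer 2 — see Two-layer plan).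

Rationale: WHY THIS LINE. Broadcasting/reconstruction on trees and strong data-processing on Bayesian networks
(EvansEtAl2000 = doi:10.1214/aoap/1019487349,
Kesten–Stigum bλ₂² = 1; PolyanskiyWu2017 Thm. on percolation of information, PolyanskiyWu2020 =
doi:10.4171/msl/10) bound the information two
leaves share through common ancestors by a sum over ancestor path pairs of products of per-edge
contraction coefficients; transplanted with
the dictionary leaf ↦ pre-collisional velocity of a collision partner, node ↦ collision, node noise
↦ impact parameter (uniform on the disc
given the coarse past = KickIsotropyInfo), edge channel ↦ the jump operator K of the linear
hard-sphere Boltzmann operator with local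
Maxwellian bath (VbobylevMossberg2008 = doi:10.3934/krm.2008.1.521, BisiCanizoLods2015 =
doi:10.1016/j.jfa.2015.05.002, Shizgal2015 =
doi:10.1080/23324309.2015.1086804), branching number ↦ 2, it gives: pair χ²-information at contact ≤
C Σ_M (2λ₂²)^M · (#common-ancestor
path pairs of total length M, ≍ 2^M/N globally and ≍ φ² 2^M/M^{3/2} locally by d = 3 transience) —
finite uniformly in time iff
2λ₂² < 1, whereas every validity proof in print (Lanford1975, GST2013, PulvirentiSimonella2016,
BGSSAnnals2023, DengHaniMa2024; collision
TREES for the Rayleigh gas, MatthiesStoneTheil2018 = doi:10.3934/krm.2018008) needs histories to be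
disjoint or their overlaps to be
expanded, which fails after O(log N) collisions and a fortiori at fixed density. Imported areas:
information theory (SDPI, information
percolation), spectral theory of the linear Boltzmann operator, hyperbolic billiard input only
through KickIsotropyInfo. What it does
that the open routes do not: DenseKineticExpansion / LaceRingBootstrap EXPAND overlapping histories
(cumulants, laces); CollisionMeasureChaos
and DissipativeWeakStrong CONSUME chaos without a mechanism; OneFlightGossip proves kick isotropy
and spends it on equilibrium variance
decay through Kac-type gaps inside kinetic windows; here kick isotropy is spent on a non-expansive,
sign-blind dilution bound valid at
all depths, and the planner's own computation (NUMBERS) shows the card's KL threshold η_KL ≤ 1/2 is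
saturated by fast particles, so the
engine is re-cut in χ² currency where the margin is 2λ₂² = 1/2 < 1. Negatives index empty at filing.

RANKED CRUXES. #3 ContactChaos (crux) — AVERAGED MOLECULAR CHAOS AT CONTACT at fixed reduced density
(shared item stmt-AtomisticToContinuum-3987 of route CollisionMeasureChaos, verbatim): for σ <
σ₀(profiles), local Gibbs data, every horizon τ, continuous space-time localiser χ and bounded
continuous mark test Ψ(ω, v, v*), the cross-ratio defect K_N[χ·Ψ·A_r] − K_N[χ·B^Ψ_r] of the
normalised empirical collision measure K_N = (ε/(N+1)) Σ_{collisions ≤ τ, ordered contact pairs}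
against the r-mollified empirical pair field → 0 in probability (N → ∞ then r → 0): pre-collisional
partners are distributed as a flux-weighted PRODUCT of the local one-particle law, rate free. In
this route it is the OUTPUT node of the percolation engine (KickIsotropyInfo + SpectralContraction +
path-pair census ⇒ uniform-in-time O(σ³) bound and vanishing off the ring sector;
RingSectorNeutrality ⇒ the ring sector) — card crux 3 'MI → 0 ⇒ kernel factorisation'. [deps:
SpectralContraction] [difficulty: open-problem] (why it might fail: dilution is only an UPPER bound:
the O(φ) ring sector (recollisions within a few flights, Soto2016 p127) carries O(1) information per
event and must cancel against local equilibrium; if 2λ₂² ≥ 1 or kicks stay anisotropic given the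
coarse past, correlations accumulate over N^{1/3} generations.) [PolyanskiyWu2017,
doi:10.4171/msl/10, doi:10.1214/aoap/1019487349, Soto2016, Lanford1975, PulvirentiSimonella2016,
Rezakhanlou2003, arXiv:1504.03215]
#4 SpectralContraction (crux) — SUBCRITICAL χ²-CONTRACTION OF THE HARD-SPHERE JUMP OPERATOR (card
crux 2 re-cut in χ² currency; the per-edge constant of the percolation bound). Let M be the standard
Maxwellian on ℝ³, S the surface measure on S², ν(v) = ∫∫ ((v−w)·ω)₊ M(w) dS(ω) dw the collision
frequency, and (K f)(v) = ν(v)⁻¹ ∫∫ ((v−w)·ω)₊ M(w) f(v − ((v−w)·ω)ω) dS(ω) dw the one-collision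
(jump) operator of a tagged sphere in a Maxwellian bath of equal spheres at the same temperature; K
is Markov, reversible with respect to the flux-weighted Maxwellian π ∝ νM. CLAIM: there is c < 1/2
with ∫ (Kf)² dπ ≤ c ∫ f² dπ for every f ∈ L²(π) with ∫ f dπ = 0, i.e. the second singular value
satisfies λ₂² < 1/2 — the information-percolation threshold 2λ₂² < 1 for binary branching
(Kesten–Stigum with b = 2, two branches per common ancestor). Linear f give exactly the momentum
transmission 1/2 (λ₂ ≥ ≈ 1/2; card Monte Carlo corr(v_x, v′_x) = 0.499, corr(|v|², |v′|²) = 0.499),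
conjecturally extremal: λ₂² = 1/4. Galilean/scaling covariance of the collision rule makes the unit
Maxwellian case cover every local equilibrium. [difficulty: M] (why it might fail: a nonlinear
(radial × angular) test function could beat the linear ones under flux weighting: λ₂² ∈ (1/4, 1/2]
is not excluded by the card's Monte Carlo, and at λ₂² = 1/2 the path-pair sum is critical (only d =
3 transience, M^{-3/2}, would save it).) [doi:10.3934/krm.2008.1.521, doi:10.1016/j.jfa.2015.05.002,
doi:10.1080/23324309.2015.1086804, doi:10.1007/978-1-4471-4863-0_23, PolyanskiyWu2017,
doi:10.1214/aoap/1019487349]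
#9 EntropyHalving (support) — SHARP KL CONTRACTION (card crux 2 as printed, with the planner's
correction that 1/2 is attained, not beaten): for every probability law P on ℝ³, one collision with
the Maxwellian bath at least HALVES the relative entropy to the flux-weighted Maxwellian π: D(PK‖π)
≤ ½ D(P‖π), PK the output law of the jump kernel (pushforward of ((v−w)·ω)₊M(w)/ν(v) dS dw dP under
(v,w,ω) ↦ v′). Fast inputs saturate it (D(PK‖π)/D(P‖π) → 1/2 as |v| → ∞: a fast sphere keeps half
its energy on average — equipartition IS the entropy transmission), so the KL-percolation sum is
exactly critical, 4η² = 1, and converges at fixed density only through d = 3 transience; near π the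
ratio is ≈ λ₂² ≈ 1/4. Conjectural and sharp; NOT load-bearing (the engine runs on
SpectralContraction) — it is the non-perturbative alternative currency, filed for idle
provers/refuters and kit Monte Carlo. [difficulty: L] [PolyanskiyWu2017,
doi:10.1109/tit.2017.2782359, doi:10.1109/isit.2013.6620260, doi:10.1016/j.jfa.2015.05.002]
#9 CollisionRate (support) — RATE / CONTACT-VALUE IDENTIFICATION (shared item
stmt-AtomisticToContinuum-3988 of route CollisionMeasureChaos, verbatim; imported closure step, not
a bet of this line): the normalised collision count localised by χ·g(σ³ρ^N_r) equals σ³ ∫∫ χ g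
Y(σ³ρ^N_r) B¹_r in probability (N → ∞ then r → 0), Y = (3/2π) f_ex′ the thermodynamic contact value
below reduced density η₀ — the positional (excluded-volume) half of the Enskog closure, which the
velocity-space percolation engine does not address. [difficulty: open-problem]
[VanbeijerenErnst1973, Resibois1978, Lachowicz1998, Soto2016]
#9 LocalSecondLaw (support) — LOCAL ENTROPY INEQUALITY IN PROBABILITY for the r-mollified empirical
fields with the hard-sphere entropy (shared item stmt-AtomisticToContinuum-3989 of route
CollisionMeasureChaos, verbatim; imported closure step consumed by the Feireisl-type weak–strong
uniqueness of that route's assembly). [difficulty: open-problem] [Resibois1978, OllaVaradhanYau1993,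
Spohn1991]
#9 DensityCap (support) — NO OVERCOMPRESSION BEFORE THE SHOCK (shared item
stmt-AtomisticToContinuum-3990 of route CollisionMeasureChaos, verbatim; imported closure step): the
mollified empirical density does not exceed the classical Euler density by η, in probability, N → ∞
then r → 0. [difficulty: L] [Spohn1991, OllaVaradhanYau1993]
#9 PermutationSymmetry (support) — A.E. EXCHANGEABILITY OF THE TIME-t DENSITY (provable now;
discharges the symmetry hypothesis of stmt-0806 for every consumer): for every σ > 0, profiles, N,
hard-sphere flow structure Φ, time t and permutation π of the labels, the transported local Gibbs
density 1_D · (canonicalDensity ∘ Φ_{−t}) is a.e. invariant under relabelling — from symmetry of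
canonicalDensity and a.e. uniqueness of the flow (HardSphereFlow.flow_eq_ae, proved: apply it to Φ
and its π-conjugate). [difficulty: provable-now] [GST2013, CIP1994, Alexander1975]

TWO-LAYER PLAN. ContactChaos ⇐ FreshSectorChaos → RingSectorNeutrality → ContactChaos (k = 2 +
glue), where FreshSectorChaos = "pre-collisional pairs whose
backward clusters are disjoint to depth m₀ have χ²-information ≤ C Σ_{M>m₀} (2λ₂²)^M × path-pair
census, uniformly on [0,T]" is the percolation
theorem instantiated (glue statement: KickIsotropyInfo → SpectralContraction → PathPairCensus →
FreshSectorChaos; PathPairCensus = E#common-ancestor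
path pairs of length M ≤ C(2^M/N + σ⁶ 2^M M^{-3/2}) from bounded collision-rate densities). A
law-level child of ContactChaos (expected collision
functional = Enskog product functional of the 1-marginal with contact value Y, trace-free; typed and
elaborated in the planner folder as `PairChaos`,
5.1k chars, with the kinetic step `KineticClosure` → stmt-0806, 4.7k chars — both above the gate's
4000-char signature limit, to be filed once the
`empiricalCollisionMeasure` definition requested by CollisionMeasureChaos lands) is held in reserve
as the alternative decomposition through marginals
(DenseKineticExpansion's waypoints) should the CollisionMeasureChaos closure stall.
SpectralContraction ⇐ AngularSectorGap (each spherical-harmonic sector ℓ of the π-reversible K) →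
RadialBound. KickIsotropyInfo ⇐ one-flight standard-pair lemma (route OneFlightGossip B1′) →
near-miss correction. Nothing filed now.

KILL CRITERIA. (i) ¬SpectralContraction (λ₂² ≥ 1/2, e.g. by an explicit radial–angular test function
or a certified Galerkin lower bound) kills the χ² engine:
pivot once to the KL engine at exact criticality (EntropyHalving + d = 3 transience), else close
`refuted:SpectralContraction`. (ii) Event-driven MD
(kit) showing pre-collisional pair correlation / mutual information at contact GROWING with the
number of collision generations past the local
horizon (instead of a plateau O(σ³) relaxing with Kn) refutes the dilution picture — close
`exhausted` with the data. (iii) ¬ContactChaos (a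
non-factorising residual of the limit collision kernel for some smooth pre-shock datum at
arbitrarily small σ) closes this route AND
CollisionMeasureChaos and strongly suggests ¬HydrodynamicLimit. (iv) KickIsotropyInfo false (O(1)
anisotropy of the kick law given the coarse
past at arbitrarily small σ, e.g. from near-miss shadowing) removes the network structure — close.
ContactChaos proved by any other engine moots
the engine items (they keep independent interest); RelEntropyVanishing (0766) or L2HydroFields
(0800) proved elsewhere moots the route.

NOT DECOMPOSED YET. The percolation theorem itself on DAGs with continuous node states
(Polyanskiy–Wu / Evans–Schulman form in χ² currency; requested as a cite fact),
the path-pair census, robustness of λ₂ under near-Maxwellian baths (perturbation of a reversible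
Markov operator), the velocity truncation that
keeps posteriors in L²(π), the concentration step from law-level chaos to one trajectory (in
probability), the definition of the collision DAG /
coarse-past filtration (definition request; shared in substance with OneFlightGossip's
HardSphereCollisionRecord), the ring-sector bootstrap
constant, d = 3 only, and everything downstream of ContactChaos (lives in CollisionMeasureChaos).
KickIsotropyInfo and RingSectorNeutrality are
filed INFORMAL right after open (they need the collision-record definition to be typed) — ranks 2
and 5.

CHEAPEST FALSIFIER. Compute λ₂(K): the jump operator is explicit, π-reversible and
rotation-invariant, so a Galerkin computation in each angular sector ℓ ≤ 4 with
≤ 20 Laguerre/Sonine radial functions, or a Monte Carlo maximisation of the Rayleigh quotient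
∫(Kf)²dπ/∫f²dπ over low-order polynomials, decides
λ₂² < 1/2 vs ≥ 1/2 in an afternoon (kit; not run in plancard mode). Done here analytically instead:
(a) linear f give quotient ≤ 1/4 (flux bias
anticorrelates, E_flux[w | v] = −μ(|v|)v̂); (b) f = |v|² gives < 1/4 (E_flux[|w|² | v] DEcreases
from 4 to 3 as |v| goes 0 → ∞); (c) the KL
ratio of a fast input tends to 1/2 ((s²/4 − 3 log s)/(s²/2 − log s)), which is why the KL form is
support only. Second cheapest: the MD
plateau test of Kill (ii).

NUMBERS. Fixed reduced density (N+1)ε³ = σ³, ε = σ(N+1)^{-1/3}; collisions per particle per unit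
time ≍ σ²(N+1)^{1/3}, ≍ N^{4/3} collisions per unit time in
all (normalisations: CollisionMeasureChaos uses ε/(N+1) per collision). Per-collision kinematics (CM
isotropy of hard spheres): v′ = (v+w)/2 +
(|v−w|/2)n, so E[v′ | v, w] = (v+w)/2 (linear transmission λ₁ = 1/2 exactly: conserved means
CRITICAL, 2λ₁ = 1) and E[|v′|² | v, w] =
(|v|²+|w|²)/2. χ²: λ₂(K) ≥ ≈ 1/2 from linear f (card MC 0.499), threshold λ₂² < 1/2, conjecture 1/4.
KL: η_KL(π, K) ≥ 1/2 (fast inputs), card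
threshold η ≤ 1/2 ⇒ exactly critical. Local branching horizon at volume fraction φ: 2^m ancestors vs
≍ φ⁻² m^{3/2} spheres within diffusive reach
⇒ m* ≈ 2 log₂(1/φ) + O(log log) ≈ 13 generations at φ = 0.05 — O(1) mean free times, against ≍
N^{1/3}t generations per Euler time. Ring
(recollision) fraction per collision ≍ φ in d = 3, dominated by flights of length O(ε) (Soto2016 pp.
126–127); Enskog contact value Y(η) = 1 +
(5π/12)η + O(η²), Carnahan–Starling χ = (1 − φ/2)/(1 − φ)³, φ = πnD³/6 (Soto2016 p. 123). Items at
open: 8 (2 typed cruxes incl. the shared ContactChaos; 5 support — EntropyHalving,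
PermutationSymmetry and the 3 shared closure
items; 1 shared assembly) + 2 informal cruxes (ranks 2, 5) and 1 definition request filed after
open.

DEFINITION REQUESTS. (1) `HardSphereCollisionRecord` / collision DAG (topic
Literature/Analysis/FluidPDE; same object as OneFlightGossip's request): for a HardSphereFlow
trajectory on [0,t] the finite marked DAG of collisions (time, ordered contact pair, impact unit
vector, pre- /post-velocities via leftLim and
collidePair), the backward cluster / ancestry relation with depth, path-pair counts, and the
σ-algebra of the r-coarse past; needed to type
KickIsotropyInfo, RingSectorNeutrality and the FreshSectorChaos glue. (2) cite fact wanted: the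
information-percolation bound for Bayesian networks
(PolyanskiyWu2017, Thm. 5-type: η_KL(X_source → X_S) ≤ P(open path), and its χ² analogue), topic
Literature/Probability. (3) optional:
`chiSqContraction` / `klContraction` coefficient of a Markov kernel relative to a reference law
(Literature/Probability; Mathlib has
InformationTheory.klDiv) — inlined in SpectralContraction / EntropyHalving for now.

Novelty: Searches (2026-08-15): `lit frontier AtomisticToContinuum --since 2020` (30 rows; DHM descendants,
two 2026 Rayleigh-gas cumulant preprints
arXiv:2605.19694/19696, CanestrariLiveraniOlla; nothing information-theoretic); `lit bridges
AtomisticToContinuum --cross any` (30 rows, none relevant);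
`lit search --source crossref "linear Boltzmann operator hard spheres spectral gap entropy
dissipation"` (12: doi:10.1016/j.jfa.2015.05.002,
doi:10.3934/krm.2008.1.521, doi:10.1080/23324309.2015.1086804, doi:10.1007/s10955-004-2267-7,
doi:10.4171/rmi/436); `lit search --source crossref
"strong data processing inequalities Bayesian networks percolation of information Polyanskiy Wu"`
(10: doi:10.1007/978-1-4939-7005-6_7,
doi:10.4171/msl/10, doi:10.1109/tit.2017.2782359, doi:10.1109/isit.2013.6620260,
doi:10.1109/isit50566.2022.9834406); `lit search --source crossref
"Kac walk spectral gap linear Boltzmann Rayleigh gas entropy contraction collision"` (10: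
doi:10.1007/978-1-4471-4863-0_23 Sasada, doi:10.3934/krm.2018008
Matthies–Stone–Theil collision trees, doi:10.1016/j.matpur.2007.03.003); `lit search --hybrid` local
×2 (Soto2016 pp. 122–131 READ: Enskog closure (4.86),
recollision fraction ≍ φ, Ex. 4.3 "in equilibrium collisions do not create correlations"; CIP1994);
zbMATH ×2 (1 hit, Lods–Mouhot–Toscani);
`lit galaxy search … --star all` ×3 attempts: service saturated (logged); arXiv/OpenAlex/S2
rate-limited today; all HydrodynamicLimit routes opened
2026-08-15 read for overlap (Collision  [refs: 10.1016/j.jfa.2015.05.002, 10.3934/krm.2008.1.521, 10.1080/23324309.2015.1086804, 10.1007/s10955-004-2267-7, 10.4171/rmi/436, 10.1007/978-1-4939-7005-6_7, 10.4171/msl/10, 10.1109/tit.2017.2782359, 10.1109/isit.2013.6620260, 10.1109/isit50566.2022.9834406, 10.1007/978-1-4471-4863-0_23, 10.3934/krm.2018008, 10.1016/j.matpur.2007.03.003, 10.1214/aoap/1019487349, 2605.19694, doi:10.1016/j.jfa.2015.05.]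

Barriers (technique_class: information-percolation, sdpi, collision-dag, spectral-gap): - technique_class: information-percolation, sdpi, collision-dag, spectral-gap
- Literature.Barriers.AtomisticToContinuum.BoltzmannHypothesisBarrier: outside its technique class
(no classification of stationary states, no one-block estimate); consistent with its kernels — for
the ideal gas there are no nodes, nothing dilutes and arbitrary velocity laws persist; for
integrable/swap scattering the transmission is λ = 1 (critical, no dilution); chaos is produced only
where collisions with fresh geometry exist (KickIsotropyInfo consumes the interaction).
- Literature.Barriers.AtomisticToContinuum.DiluteRegimeBarrier: evaded in form and target — no
Boltzmann–Grad limit, σ³ fixed, the output ContactChaos feeds an Enskog-rate closure with the full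
hsPressure (CollisionRate); in substance the dilution bound is the first chaos argument that does
not degrade with the number of collisions per particle, which is exactly what the barrier's printed
scope (α ≲ (log log N)^{1/2}) lacks; the bet is KickIsotropyInfo at fixed σ.
- Literature.Barriers.AtomisticToContinuum.NoDensityExpansionBarrier: not met — nothing is expanded
in density or in collision sequences and no transport coefficient is computed (Euler order); its
ring physics is isolated as the O(φ) sector the sign-blind bound cannot remove and is handed to
RingSectorNeutrality (cancellation against local equilibrium, Soto2016 Ex. 4.3), never resummed.
- Literature.Barriers.AtomisticToContinuum.HighMomentumCutoffBarrier: partly engaged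

History (route lifecycle, newest last):
- 2026-08-15T13:43:26Z · CLOSED retired — not-a-thesis: assembly does not conclude the sub-problem Statement (operator:999:1257524)

sub-problem: HydrodynamicLimit · status: closed(retired) · opened planner-plancard-AtomisticToContinuum-Hydrody-af3268db-0 2026-08-15T12:02:37Z · rev 1 · ledger route-AtomisticToContinuum-InformationPercolation
GENERATED by the gate from the ledger (D-0016/17). Provers cite these decls: `theorem foo : Summit.AtomisticToContinuum.HydrodynamicLimit.Theses.InformationPercolation.<Decl> := …` in Summits/AtomisticToContinuum/HydrodynamicLimit/Theorems/<Name>.lean.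
-/

namespace Summit.AtomisticToContinuum.HydrodynamicLimit.Theses.InformationPercolation

open scoped BigOperators Topology Manifold Classical MeasureTheory ProbabilityTheory Matrix InnerProductSpace ComplexConjugate ContinuousMap
open Filter Set Function TopologicalSpace MeasureTheory

attribute [summit_statement] _root_.HydrodynamicLimit

-- item stmt-AtomisticToContinuum-7355 · crux · rank 2 · closed · moot by None · by planner — informal only, no Lean statement yet:
--   [crux] CONDITIONAL KICK ISOTROPY GIVEN THE COARSE PAST (impact-parameter equidistribution in
--   information form; card crux 1; the same object as B1′ 'OneFlightLayeredChaos' of route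
--   OneFlightGossip — give both ONE shared signature when the collision-record definition lands). For
--   hard-sphere flows on 𝕋³ at fixed reduced density σ < σ₀(profiles) started from the local Gibbs law
--   and t < T: for all collisions in [0,t] outside an exceptional RING set of relative frequency ≤ Cσ³ +
--   o_N(1) (the two partners, or a partner and a sphere it met within its last m₀ flights, share a
--   collision at depth ≤ m₀), t

/-- item stmt-AtomisticToContinuum-3987 · crux · rank 3 · closed · moot by None · by planner
why it might fail: dilution is only an UPPER bound: the O(φ) ring sector (recollisions within a few flights, Soto2016 p127) carries O(1) information per event and must cancel against local equilibrium; if 2λ₂² ≥ 1 or kicks stay anisotropic given the coarse past, correlations accumulate over N^{1/3} generations.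
sources: PolyanskiyWu2017, doi:10.4171/msl/10, doi:10.1214/aoap/1019487349, Soto2016, Lanford1975, PulvirentiSimonella2016
[crux] AVERAGED MOLECULAR CHAOS AT CONTACT FOR THE LIMIT (card crux 1). For σ < σ₀(profiles), local
Gibbs data, every horizon τ, every continuous space-time localiser χ and bounded continuous mark
test Ψ(ω, v, v*): the cross-ratio defect D_N = K_N[χ·Ψ·A_r] − K_N[χ·B^Ψ_r] → 0 in probability as N →
∞ then r → 0, where K_N[F] = (ε/(N+1)) Σ_{collisions s ≤ τ, ordered contact pairs (i,j)} F evaluated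
at (s, x_i, ω = (x_i−x_j)/ε, pre-collisional (v_i, v_j) = reflectVel), and A_r, B^Ψ_r are the
r-mollified empirical pair fields ∫∫ Θ(v,w) μ^N_s⊗μ^N_s near (s, x) with Θ_1 = ∫((v−w)·ω)₋dω and Θ_Ψ
= ∫Ψ(ω,v,w)((v−w)·ω)₋dω. In the limit this says κ̄_{t,x}(Ψ)·⟨μ̄⊗μ̄, Θ_1⟩ = κ̄_{t,x}(1)·⟨μ̄⊗μ̄, Θ_Ψ⟩
a.e., i.e. κ̄_{t,x} = λ(t,x)((v−v*)·ω)₋ dω μ̄_{t,x}(dv) μ̄_{t,x}(dv*) with the rate λ free.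
[difficulty: open-problem] -/
@[route_item "route-AtomisticToContinuum-InformationPercolation"]
def ContactChaos : Prop :=
  ∀ (a₀ θ₀ : Literature.MathematicalPhysics.KineticTheory.T3 → ℝ) (u₀ : Literature.MathematicalPhysics.KineticTheory.T3 → Literature.MathematicalPhysics.KineticTheory.V3), Continuous a₀ → Continuous θ₀ → Continuous u₀ → (∀ x, 0 < a₀ x) → (∀ x, 0 < θ₀ x) → ∃ σ₀ : ℝ, 0 < σ₀ ∧ ∀ σ : ℝ, 0 < σ → σ < σ₀ → ∀ Φ : (N : ℕ) → Literature.Analysis.FluidPDE.HardSphereFlow (Literature.Analysis.FluidPDE.Torus.geometry (Fin 3)) (Literature.MathematicalPhysics.KineticTheory.hsDiameter σ N) (N + 1), ∀ τ : ℝ, 0 < τ → ∀ χ : ℝ × Literature.MathematicalPhysics.KineticTheory.T3 → ℝ, Continuous χ → ∀ Ψ : Literature.MathematicalPhysics.KineticTheory.V3 × Literature.MathematicalPhysics.KineticTheory.V3 × Literature.MathematicalPhysics.KineticTheory.V3 → ℝ, Continuous Ψ → (∃ C : ℝ, ∀ p, |Ψ p| ≤ C) → ∀ η δ : ℝ, 0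 < η → 0 < δ → ∃ r₀ : ℝ, 0 < r₀ ∧ ∀ r : ℝ, 0 < r → r < r₀ → ∃ N₀ : ℕ, ∀ N : ℕ, N₀ ≤ N → let ε := Literature.MathematicalPhysics.KineticTheory.hsDiameter σ N; let G : Literature.Analysis.FluidPDE.Geometry (Fin 3) Literature.MathematicalPhysics.KineticTheory.T3 := Literature.Analysis.FluidPDE.Torus.geometry (Fin 3); let γ : Literature.Analysis.FluidPDE.Config (N + 1) (Fin 3) Literature.MathematicalPhysics.KineticTheory.T3 → ℝ → Literature.Analysis.FluidPDE.Config (N + 1) (Fin 3) Literature.MathematicalPhysics.KineticTheory.T3 := fun z s => (Φ N).flow s z; let bx : Literature.MathematicalPhysics.KineticTheory.T3 → Literature.MathematicalPhysics.KineticTheory.T3 → ℝ := fun x y => 3 / (Real.pi * r ^ 3) * max (1 - Literature.Analysis.FluidPDE.Torus.euclidDist x y / r) 0; let bt : ℝ → ℝ := fun a => r⁻¹ * max (1 - |a| / r) 0; let Θ := fun (Ξ : Literature.MathematicalPhysics.KineticTheory.V3 × Literature.MathematicalPhysics.KineticTheory.V3 × Literature.MathematicalPhysics.KineticTheory.V3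 → ℝ) (v w : Literature.MathematicalPhysics.KineticTheory.V3) => ∫ ω : Metric.sphere (0 : Literature.MathematicalPhysics.KineticTheory.V3) 1, Ξ ((ω : Literature.MathematicalPhysics.KineticTheory.V3), v, w) * Literature.MathematicalPhysics.KineticTheory.hardSphereKernel (w, v) ω ∂Literature.MathematicalPhysics.KineticTheory.sphereMeasure; let Pm : (Literature.MathematicalPhysics.KineticTheory.V3 → Literature.MathematicalPhysics.KineticTheory.V3 → ℝ) → Literature.Analysis.FluidPDE.Config (N + 1) (Fin 3) Literature.MathematicalPhysics.KineticTheory.T3 → ℝ → Literature.MathematicalPhysics.KineticTheory.T3 → ℝ := fun Th z s₀ x₀ => ∫ s in Set.Icc (0 : ℝ) τ, bt (s - s₀) * ∫ p, bx p.1.1 x₀ * bx p.2.1 x₀ * Th p.1.2 p.2.2 ∂((Literature.Analysis.FluidPDE.empiricalMeasure (γ z s)).prod (Literature.Analysis.FluidPDE.empiricalMeasure (γ z s))); let Kc : (Literature.Analysis.FluidPDE.Config (N + 1) (Fin 3) Literature.MathematicalPhysics.KineticTheory.T3 → ℝ → Fin (N + 1) → Fin (N + 1) → ℝ) → Literature.Analysis.FluidPDE.Config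 (N + 1) (Fin 3) Literature.MathematicalPhysics.KineticTheory.T3 → ℝ := fun F z => ε / (N + 1 : ℝ) * ∑ᶠ (s : ℝ) (_ : s ∈ Literature.Analysis.FluidPDE.collisionTimes G ε (γ z) ∩ Set.Icc 0 τ), ∑ i : Fin (N + 1), ∑ j : Fin (N + 1), (if i ≠ j ∧ ‖G.sepVec (γ z s i).1 (γ z s j).1‖ = ε then F z s i j else 0); let pv : Literature.Analysis.FluidPDE.Config (N + 1) (Fin 3) Literature.MathematicalPhysics.KineticTheory.T3 → ℝ → Fin (N + 1) → Fin (N + 1) → Literature.MathematicalPhysics.KineticTheory.V3 × Literature.MathematicalPhysics.KineticTheory.V3 := fun z s i j => Literature.Analysis.FluidPDE.reflectVel (G.sepVec (γ z s i).1 (γ z s j).1) ((γ z s i).2, (γ z s j).2); let D := fun z : Literature.Analysis.FluidPDE.Config (N + 1) (Fin 3) Literature.MathematicalPhysics.KineticTheory.T3 => Kc (fun z s i j => χ (s, (γ z s i).1) * Ψ (ε⁻¹ • G.sepVec (γ z s i).1 (γ z s j).1, (pv z s i j).1, (pv z s i j).2) * Pm (Θ (fun _ => 1)) z s (γ z s i).1)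 z - Kc (fun z s i _ => χ (s, (γ z s i).1) * Pm (Θ Ψ) z s (γ z s i).1) z; Literature.MathematicalPhysics.KineticTheory.localGibbsLaw σ a₀ u₀ θ₀ N (Φ N) {z | η < |D z|} ≤ ENNReal.ofReal δ

/-- item stmt-AtomisticToContinuum-7116 · crux · rank 4 · closed · moot by None · by planner
why it might fail: a nonlinear (radial × angular) test function could beat the linear ones under flux weighting: λ₂² ∈ (1/4, 1/2] is not excluded by the card's Monte Carlo, and at λ₂² = 1/2 the path-pair sum is critical (only d = 3 transience, M^{-3/2}, would save it).
sources: doi:10.3934/krm.2008.1.521, doi:10.1016/j.jfa.2015.05.002, doi:10.1080/23324309.2015.1086804, doi:10.1007/978-1-4471-4863-0_23, PolyanskiyWu2017, doi:10.1214/aoap/1019487349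
[crux] SUBCRITICAL χ²-CONTRACTION OF THE HARD-SPHERE JUMP OPERATOR (card crux 2 re-cut in χ²
currency; the per-edge constant of the percolation bound). Let M be the standard Maxwellian on ℝ³, S
the surface measure on S², ν(v) = ∫∫ ((v−w)·ω)₊ M(w) dS(ω) dw the collision frequency, and (K f)(v)
= ν(v)⁻¹ ∫∫ ((v−w)·ω)₊ M(w) f(v − ((v−w)·ω)ω) dS(ω) dw the one-collision (jump) operator of a tagged
sphere in a Maxwellian bath of equal spheres at the same temperature; K is Markov, reversible with
respect to the flux-weighted Maxwellian π ∝ νM. CLAIM: there is c < 1/2 with ∫ (Kf)² dπ ≤ c ∫ f² dπ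
for every f ∈ L²(π) with ∫ f dπ = 0, i.e. the second singular value satisfies λ₂² < 1/2 — the
information-percolation threshold 2λ₂² < 1 for binary branching (Kesten–Stigum with b = 2, two
branches per common ancestor). Linear f give exactly the momentum transmission 1/2 (λ₂ ≥ ≈ 1/2; card
Monte Carlo corr(v_x, v′_x) = 0.499, corr(|v|², |v′|²) = 0.499), conjecturally extremal: λ₂² = 1/4.
Galilean/scaling covariance of the collision rule makes the unit Maxwellian case cover every local
equilibrium. [difficulty: M] -/
@[route_item "route-AtomisticToContinuum-InformationPercolation"]
def SpectralContraction : Prop :=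
  ∃ c : ℝ, c < 1 / 2 ∧ let M : Literature.MathematicalPhysics.KineticTheory.V3 → ℝ := Literature.Analysis.FluidPDE.globalMaxwellian; let S : MeasureTheory.Measure (Metric.sphere (0 : Literature.MathematicalPhysics.KineticTheory.V3) 1) := Literature.MathematicalPhysics.KineticTheory.sphereMeasure; let ν : Literature.MathematicalPhysics.KineticTheory.V3 → ℝ := fun v => ∫ w, ∫ ω, Literature.MathematicalPhysics.KineticTheory.hardSphereKernel (v, w) ω * M w ∂S; let K : (Literature.MathematicalPhysics.KineticTheory.V3 → ℝ) → Literature.MathematicalPhysics.KineticTheory.V3 → ℝ := fun f v => (ν v)⁻¹ * ∫ w, ∫ ω, Literature.MathematicalPhysics.KineticTheory.hardSphereKernel (v, w) ω * M w * f (Literature.MathematicalPhysics.KineticTheory.collide ω (v, w)).1 ∂S; ∀ f : Literature.MathematicalPhysics.KineticTheory.V3 → ℝ, MeasureTheory.Integrable (fun v => f v ^ 2 * (ν v * M v)) → ∫ v, f v * (ν v * M v) = 0 → ∫ v, K f v ^ 2 * (ν v * M v) ≤ c * ∫ v, f v ^ 2 * (ν v * M v)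

-- item stmt-AtomisticToContinuum-7380 · crux · rank 5 · closed · moot by None · by planner — informal only, no Lean statement yet:
--   [crux] RING-SECTOR NEUTRALITY AT FIXED DENSITY (card thesis T2 turned into a statement; the part of
--   ContactChaos that dilution cannot give). Setting of ContactChaos (σ < σ₀(profiles), local Gibbs
--   data, classical hs-Euler solution on [0,T), t < T). Split the collisions in [0,t] into FRESH ones
--   (backward collision clusters of the two partners disjoint down to depth m₀) and RING ones (the
--   complement: recollisions and short cycles — a fraction ≍ σ³ per collision in d = 3 at every N,
--   dominated by intermediate flights of length O(ε), Soto2016 pp.126–127; Cohen1967 §2). CLAIM: for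
--   every fixed m₀, the

/-- item stmt-AtomisticToContinuum-3988 · support · rank 9 · closed · moot by None · by planner
sources: VanbeijerenErnst1973, Resibois1978, Lachowicz1998, Soto2016
[crux] RATE / CONTACT-VALUE IDENTIFICATION (card crux 2, Enskog form B). There is a universal η₀ > 0
such that for σ < σ₀(profiles), local Gibbs data, every τ, χ and every continuous cutoff g vanishing
on [η₀, ∞): K_N[χ·g(σ³ρ^N_r)] − σ³ ∫_0^τ∫_{𝕋³} χ g(σ³ρ^N_r) Y(σ³ρ^N_r) B¹_r dx ds → 0 in probability
(N → ∞ then r → 0), with ρ^N_r the r-mollified empirical density, B¹_r = ∫∫ π|v−w| (mollified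
μ^N_s⊗μ^N_s) and Y(η) = (3/2π)·deriv hsExcessFreeEnergy η the thermodynamic contact value
((Z−1)/((2π/3)η)). In the limit: κ̄_{t,x}(1) = σ³ Y(σ³ρ̄) π∫∫|v−w| μ̄_{t,x} μ̄_{t,x} wherever σ³ρ̄ <
η₀ — the Enskog collision frequency, which with ContactChaos and Maxwellian μ̄ yields p = hsPressure
σ ρ θ exactly (kinetic ρθ + collisional transfer (2π/3)σ³Yρ²θ). [deps: ContactChaos] [difficulty:
open-problem] -/
@[route_item "route-AtomisticToContinuum-InformationPercolation"]
def CollisionRate : Prop :=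
  ∃ η₀ : ℝ, 0 < η₀ ∧ ∀ (a₀ θ₀ : Literature.MathematicalPhysics.KineticTheory.T3 → ℝ) (u₀ : Literature.MathematicalPhysics.KineticTheory.T3 → Literature.MathematicalPhysics.KineticTheory.V3), Continuous a₀ → Continuous θ₀ → Continuous u₀ → (∀ x, 0 < a₀ x) → (∀ x, 0 < θ₀ x) → ∃ σ₀ : ℝ, 0 < σ₀ ∧ ∀ σ : ℝ, 0 < σ → σ < σ₀ → ∀ Φ : (N : ℕ) → Literature.Analysis.FluidPDE.HardSphereFlow (Literature.Analysis.FluidPDE.Torus.geometry (Fin 3)) (Literature.MathematicalPhysics.KineticTheory.hsDiameter σ N) (N + 1), ∀ τ : ℝ, 0 < τ → ∀ χ : ℝ × Literature.MathematicalPhysics.KineticTheory.T3 → ℝ, Continuous χ → ∀ g : ℝ → ℝ, Continuous g → (∀ a, η₀ ≤ a → g a = 0) → ∀ η δ : ℝ, 0 < η → 0 < δ → ∃ r₀ : ℝ, 0 < r₀ ∧ ∀ r : ℝ, 0 < r → r < r₀ → ∃ N₀ : ℕ, ∀ N : ℕ, N₀ ≤ N → let ε := Literature.MathematicalPhysics.KineticTheory.hsDiameter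 σ N; let G : Literature.Analysis.FluidPDE.Geometry (Fin 3) Literature.MathematicalPhysics.KineticTheory.T3 := Literature.Analysis.FluidPDE.Torus.geometry (Fin 3); let γ : Literature.Analysis.FluidPDE.Config (N + 1) (Fin 3) Literature.MathematicalPhysics.KineticTheory.T3 → ℝ → Literature.Analysis.FluidPDE.Config (N + 1) (Fin 3) Literature.MathematicalPhysics.KineticTheory.T3 := fun z s => (Φ N).flow s z; let bx : Literature.MathematicalPhysics.KineticTheory.T3 → Literature.MathematicalPhysics.KineticTheory.T3 → ℝ := fun x y => 3 / (Real.pi * r ^ 3) * max (1 - Literature.Analysis.FluidPDE.Torus.euclidDist x y / r) 0; let ρm : Literature.Analysis.FluidPDE.Config (N + 1) (Fin 3) Literature.MathematicalPhysics.KineticTheory.T3 → ℝ → Literature.MathematicalPhysics.KineticTheory.T3 → ℝ := fun z s x₀ => ∫ q, bx q.1 x₀ ∂(Literature.Analysis.FluidPDE.empiricalMeasure (γ z s)); let B1 : Literature.Analysis.FluidPDE.Config (N + 1) (Fin 3) Literature.MathematicalPhysics.KineticTheory.T3 → ℝ → Literature.MathematicalPhysics.KineticTheory.T3 → ℝ :=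 fun z s x₀ => ∫ p, bx p.1.1 x₀ * bx p.2.1 x₀ * (Real.pi * ‖p.1.2 - p.2.2‖) ∂((Literature.Analysis.FluidPDE.empiricalMeasure (γ z s)).prod (Literature.Analysis.FluidPDE.empiricalMeasure (γ z s))); let Kc : (Literature.Analysis.FluidPDE.Config (N + 1) (Fin 3) Literature.MathematicalPhysics.KineticTheory.T3 → ℝ → Fin (N + 1) → Fin (N + 1) → ℝ) → Literature.Analysis.FluidPDE.Config (N + 1) (Fin 3) Literature.MathematicalPhysics.KineticTheory.T3 → ℝ := fun F z => ε / (N + 1 : ℝ) * ∑ᶠ (s : ℝ) (_ : s ∈ Literature.Analysis.FluidPDE.collisionTimes G ε (γ z) ∩ Set.Icc 0 τ), ∑ i : Fin (N + 1), ∑ j : Fin (N + 1), (if i ≠ j ∧ ‖G.sepVec (γ z s i).1 (γ z s j).1‖ = ε then F z s i j else 0); let Y : ℝ → ℝ := fun a => 3 / (2 * Real.pi) * deriv Literature.MathematicalPhysics.KineticTheory.hsExcessFreeEnergy a; let D : Literature.Analysis.FluidPDE.Config (N + 1) (Fin 3) Literature.MathematicalPhysics.KineticTheory.T3 → ℝ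 := fun z => Kc (fun z s i _ => χ (s, (γ z s i).1) * g (σ ^ 3 * ρm z s (γ z s i).1)) z - σ ^ 3 * ∫ s in Set.Icc (0 : ℝ) τ, ∫ x : Literature.MathematicalPhysics.KineticTheory.T3, χ (s, x) * g (σ ^ 3 * ρm z s x) * Y (σ ^ 3 * ρm z s x) * B1 z s x; Literature.MathematicalPhysics.KineticTheory.localGibbsLaw σ a₀ u₀ θ₀ N (Φ N) {z | η < |D z|} ≤ ENNReal.ofReal δ

/-- item stmt-AtomisticToContinuum-3989 · support · rank 9 · closed · moot by None · by planner
sources: Resibois1978, OllaVaradhanYau1993, Spohn1991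
[crux] LOCAL ENTROPY INEQUALITY IN PROBABILITY for the r-mollified empirical fields (ρ, m, e)^N_r
with θ = (2/3)(e/ρ − |m|²/2ρ²) and mathematical entropy H(ρ,θ) = −ρ(3/2 log θ − log ρ −
hsExcessFreeEnergy(ρσ³)): for every smooth φ ≥ 0 supported in [0,τ) × 𝕋³, P(∫∫ H (∂_sφ + (m/ρ)·∇φ)
dx ds + ∫ H(ρ(0),θ(0)) φ(0) dx < −η) → 0 as N → ∞ then r → 0, under the conjunct's hypotheses (Euler
data (ρ,u,θ)(0) = limits of the local Gibbs fields). This is the admissibility the Feireisl–Novotný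
/ Březina–Feireisl relative-energy method consumes for the COMPLETE Euler system (energy only
globally, exact here); the GLOBAL Clausius inequality in expectation is free (Liouville + Gibbs
variational bound), the local one is not. [difficulty: open-problem] -/
@[route_item "route-AtomisticToContinuum-InformationPercolation"]
def LocalSecondLaw : Prop :=
  ∀ (a₀ θ₀ : Literature.MathematicalPhysics.KineticTheory.T3 → ℝ) (u₀ : Literature.MathematicalPhysics.KineticTheory.T3 → Literature.MathematicalPhysics.KineticTheory.V3), Continuous a₀ → Continuous θ₀ → Continuous u₀ → (∀ x, 0 < a₀ x) → (∀ x, 0 < θ₀ x) → ∃ σ₀ : ℝ, 0 < σ₀ ∧ ∀ σ : ℝ, 0 < σ → σ < σ₀ → ∀ (T : ℝ) (ρ θ : ℝ → Literature.MathematicalPhysics.KineticTheory.T3 → ℝ) (u : ℝ → Literature.MathematicalPhysics.KineticTheory.T3 → Literature.MathematicalPhysics.KineticTheory.V3), Literature.MathematicalPhysics.KineticTheory.IsHardSphereEulerSolution σ T ρ u θ → ∀ Φ : (N : ℕ) → Literature.Analysis.FluidPDE.HardSphereFlow (Literature.Analysis.FluidPDE.Torus.geometry (Fin 3)) (Literature.MathematicalPhysics.KineticTheory.hsDiameter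 σ N) (N + 1), Literature.MathematicalPhysics.KineticTheory.TendstoHydroFieldsAt (fun N => Literature.MathematicalPhysics.KineticTheory.localGibbsLaw σ a₀ u₀ θ₀ N (Φ N)) Φ ρ u θ 0 → 0 < T → ∀ τ : ℝ, 0 < τ → ∀ φ : ℝ → Literature.MathematicalPhysics.KineticTheory.T3 → ℝ, Literature.Analysis.FunctionSpaces.Torus.IsSmoothSpaceTimeOn Set.univ φ → (∀ s x, 0 ≤ φ s x) → (∃ τ' : ℝ, τ' < τ ∧ ∀ s, τ' ≤ s → ∀ x, φ s x = 0) → ∀ η δ : ℝ, 0 < η → 0 < δ → ∃ r₀ : ℝ, 0 < r₀ ∧ ∀ r : ℝ, 0 < r → r < r₀ → ∃ N₀ : ℕ, ∀ N : ℕ, N₀ ≤ N → let γ : Literature.Analysis.FluidPDE.Config (N + 1) (Fin 3) Literature.MathematicalPhysics.KineticTheory.T3 → ℝ → Literature.Analysis.FluidPDE.Config (N + 1) (Fin 3) Literature.MathematicalPhysics.KineticTheory.T3 := fun z s => (Φ N).flow s z; let bx : Literature.MathematicalPhysics.KineticTheory.T3 → Literature.MathematicalPhysics.KineticTheory.T3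 → ℝ := fun x y => 3 / (Real.pi * r ^ 3) * max (1 - Literature.Analysis.FluidPDE.Torus.euclidDist x y / r) 0; let ρm : Literature.Analysis.FluidPDE.Config (N + 1) (Fin 3) Literature.MathematicalPhysics.KineticTheory.T3 → ℝ → Literature.MathematicalPhysics.KineticTheory.T3 → ℝ := fun z s x₀ => ∫ q, bx q.1 x₀ ∂(Literature.Analysis.FluidPDE.empiricalMeasure (γ z s)); let mm : Literature.Analysis.FluidPDE.Config (N + 1) (Fin 3) Literature.MathematicalPhysics.KineticTheory.T3 → ℝ → Literature.MathematicalPhysics.KineticTheory.T3 → Literature.MathematicalPhysics.KineticTheory.V3 := fun z s x₀ => ∫ q, bx q.1 x₀ • q.2 ∂(Literature.Analysis.FluidPDE.empiricalMeasure (γ z s)); let em : Literature.Analysis.FluidPDE.Config (N + 1) (Fin 3) Literature.MathematicalPhysics.KineticTheory.T3 → ℝ → Literature.MathematicalPhysics.KineticTheory.T3 → ℝ := fun z s x₀ => ∫ q, bx q.1 x₀ * (‖q.2‖ ^ 2 / 2) ∂(Literature.Analysis.FluidPDE.empiricalMeasure (γ z s)); let θm : Literature.Analysis.FluidPDE.Config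 (N + 1) (Fin 3) Literature.MathematicalPhysics.KineticTheory.T3 → ℝ → Literature.MathematicalPhysics.KineticTheory.T3 → ℝ := fun z s x₀ => 2 / 3 * (em z s x₀ / ρm z s x₀ - ‖mm z s x₀‖ ^ 2 / (2 * ρm z s x₀ ^ 2)); let Hs : ℝ → ℝ → ℝ := fun a b => if 0 < a ∧ 0 < b then -(a * (3 / 2 * Real.log b - Real.log a - Literature.MathematicalPhysics.KineticTheory.hsExcessFreeEnergy (a * σ ^ 3))) else 0; let I : Literature.Analysis.FluidPDE.Config (N + 1) (Fin 3) Literature.MathematicalPhysics.KineticTheory.T3 → ℝ := fun z => ∫ s in Set.Icc (0 : ℝ) τ, ∫ x : Literature.MathematicalPhysics.KineticTheory.T3, Hs (ρm z s x) (θm z s x) * (deriv (fun s' => φ s' x) s + ∑ k : Fin 3, (mm z s x) k / ρm z s x * Literature.Analysis.FunctionSpaces.Torus.partialDeriv k (φ s) x); Literature.MathematicalPhysics.KineticTheory.localGibbsLaw σ a₀ u₀ θ₀ N (Φ N) {z | I z + ∫ x : Literature.MathematicalPhysics.KineticTheory.T3, Hs (ρ 0 x) (θ 0 x) * φ 0 x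 < -η} ≤ ENNReal.ofReal δ

/-- item stmt-AtomisticToContinuum-3990 · support · rank 9 · closed · moot by None · by planner
sources: Spohn1991, OllaVaradhanYau1993
[crux] NO OVERCOMPRESSION BEFORE THE SHOCK: under the conjunct's hypotheses, for every t < T and η >
0, P(∃ s ≤ t, ∃ x: ρ^N_r(s,x) > ρ(s,x) + η) → 0 as N → ∞ then r → 0 (ρ = the classical Euler
density). Needed because on sets of reduced density ≥ η₀ the collisional fluxes are neither
identified (CollisionRate is cut off) nor a priori bounded (contact values blow up toward close
packing), so they cannot be absorbed in the relative-energy Gronwall; at each FIXED scale r a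
scale-dependent cap is free by entropy transfer against the invariant Gibbs law, the scale-uniform
one-sided bound is not. [difficulty: L] -/
@[route_item "route-AtomisticToContinuum-InformationPercolation"]
def DensityCap : Prop :=
  ∀ (a₀ θ₀ : Literature.MathematicalPhysics.KineticTheory.T3 → ℝ) (u₀ : Literature.MathematicalPhysics.KineticTheory.T3 → Literature.MathematicalPhysics.KineticTheory.V3), Continuous a₀ → Continuous θ₀ → Continuous u₀ → (∀ x, 0 < a₀ x) → (∀ x, 0 < θ₀ x) → ∃ σ₀ : ℝ, 0 < σ₀ ∧ ∀ σ : ℝ, 0 < σ → σ < σ₀ → ∀ (T : ℝ) (ρ θ : ℝ → Literature.MathematicalPhysics.KineticTheory.T3 → ℝ) (u : ℝ → Literature.MathematicalPhysics.KineticTheory.T3 → Literature.MathematicalPhysics.KineticTheory.V3), Literature.MathematicalPhysics.KineticTheory.IsHardSphereEulerSolution σ T ρ u θ → ∀ Φ : (N : ℕ) → Literature.Analysis.FluidPDE.HardSphereFlow (Literature.Analysis.FluidPDE.Torus.geometry (Fin 3)) (Literature.MathematicalPhysics.KineticTheory.hsDiameter σ N) (N + 1), Literature.MathematicalPhysics.KineticTheory.TendstoHydroFieldsAt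 (fun N => Literature.MathematicalPhysics.KineticTheory.localGibbsLaw σ a₀ u₀ θ₀ N (Φ N)) Φ ρ u θ 0 → ∀ t ∈ Set.Ico 0 T, ∀ η δ : ℝ, 0 < η → 0 < δ → ∃ r₀ : ℝ, 0 < r₀ ∧ ∀ r : ℝ, 0 < r → r < r₀ → ∃ N₀ : ℕ, ∀ N : ℕ, N₀ ≤ N → let γ : Literature.Analysis.FluidPDE.Config (N + 1) (Fin 3) Literature.MathematicalPhysics.KineticTheory.T3 → ℝ → Literature.Analysis.FluidPDE.Config (N + 1) (Fin 3) Literature.MathematicalPhysics.KineticTheory.T3 := fun z s => (Φ N).flow s z; let bx : Literature.MathematicalPhysics.KineticTheory.T3 → Literature.MathematicalPhysics.KineticTheory.T3 → ℝ := fun x y => 3 / (Real.pi * r ^ 3) * max (1 - Literature.Analysis.FluidPDE.Torus.euclidDist x y / r) 0; let ρm : Literature.Analysis.FluidPDE.Config (N + 1) (Fin 3) Literature.MathematicalPhysics.KineticTheory.T3 → ℝ → Literature.MathematicalPhysics.KineticTheory.T3 → ℝ := fun z s x₀ => ∫ q, bx q.1 x₀ ∂(Literature.Analysis.FluidPDE.empiricalMeasure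 (γ z s)); Literature.MathematicalPhysics.KineticTheory.localGibbsLaw σ a₀ u₀ θ₀ N (Φ N) {z | ∃ s ∈ Set.Icc 0 t, ∃ x : Literature.MathematicalPhysics.KineticTheory.T3, ρ s x + η < ρm z s x} ≤ ENNReal.ofReal δ

/-- item stmt-AtomisticToContinuum-7117 · support · rank 9 · closed · moot by None · by planner
sources: PolyanskiyWu2017, doi:10.1109/tit.2017.2782359, doi:10.1109/isit.2013.6620260, doi:10.1016/j.jfa.2015.05.002
[support] SHARP KL CONTRACTION (card crux 2 as printed, with the planner's correction that 1/2 is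
attained, not beaten): for every probability law P on ℝ³, one collision with the Maxwellian bath at
least HALVES the relative entropy to the flux-weighted Maxwellian π: D(PK‖π) ≤ ½ D(P‖π), PK the
output law of the jump kernel (pushforward of ((v−w)·ω)₊M(w)/ν(v) dS dw dP under (v,w,ω) ↦ v′). Fast
inputs saturate it (D(PK‖π)/D(P‖π) → 1/2 as |v| → ∞: a fast sphere keeps half its energy on average
— equipartition IS the entropy transmission), so the KL-percolation sum is exactly critical, 4η² =
1, and converges at fixed density only through d = 3 transience; near π the ratio is ≈ λ₂² ≈ 1/4.
Conjectural and sharp; NOT load-bearing (the engine runs on SpectralContraction) — it is the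
non-perturbative alternative currency, filed for idle provers/refuters and kit Monte Carlo.
[difficulty: L] -/
@[route_item "route-AtomisticToContinuum-InformationPercolation"]
def EntropyHalving : Prop :=
  let M : Literature.MathematicalPhysics.KineticTheory.V3 → ℝ := Literature.Analysis.FluidPDE.globalMaxwellian; let S : MeasureTheory.Measure (Metric.sphere (0 : Literature.MathematicalPhysics.KineticTheory.V3) 1) := Literature.MathematicalPhysics.KineticTheory.sphereMeasure; let ν : Literature.MathematicalPhysics.KineticTheory.V3 → ℝ := fun v => ∫ w, ∫ ω, Literature.MathematicalPhysics.KineticTheory.hardSphereKernel (v, w) ω * M w ∂S; let πm : MeasureTheory.Measure Literature.MathematicalPhysics.KineticTheory.V3 := (MeasureTheory.volume : MeasureTheory.Measure Literature.MathematicalPhysics.KineticTheory.V3).withDensity (fun v => ENNReal.ofReal (ν v * M v / ∫ v', ν v' * M v')); let PK : MeasureTheory.Measure Literature.MathematicalPhysics.KineticTheory.V3 → MeasureTheory.Measure Literature.MathematicalPhysics.KineticTheory.V3 := fun P => ((P.prod ((MeasureTheory.volume : MeasureTheory.Measure Literature.MathematicalPhysics.KineticTheory.V3).prod S)).withDensity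 (fun q => ENNReal.ofReal (Literature.MathematicalPhysics.KineticTheory.hardSphereKernel (q.1, q.2.1) q.2.2 * M q.2.1 / ν q.1))).map (fun q => (Literature.MathematicalPhysics.KineticTheory.collide q.2.2 (q.1, q.2.1)).1); ∀ P : MeasureTheory.Measure Literature.MathematicalPhysics.KineticTheory.V3, MeasureTheory.IsProbabilityMeasure P → InformationTheory.klDiv (PK P) πm ≤ ENNReal.ofReal (1 / 2) * InformationTheory.klDiv P πm

/-- item stmt-AtomisticToContinuum-7118 · support · rank 9 · closed · moot by None · by planner
sources: GST2013, CIP1994, Alexander1975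
[support] A.E. EXCHANGEABILITY OF THE TIME-t DENSITY (provable now; discharges the symmetry
hypothesis of stmt-0806 for every consumer): for every σ > 0, profiles, N, hard-sphere flow
structure Φ, time t and permutation π of the labels, the transported local Gibbs density 1_D ·
(canonicalDensity ∘ Φ_{−t}) is a.e. invariant under relabelling — from symmetry of canonicalDensity
and a.e. uniqueness of the flow (HardSphereFlow.flow_eq_ae, proved: apply it to Φ and its
π-conjugate). [difficulty: provable-now] -/
@[route_item "route-AtomisticToContinuum-InformationPercolation"]
def PermutationSymmetry : Prop :=
  ∀ (σ : ℝ) (a₀ θ₀ : Literature.MathematicalPhysics.KineticTheory.T3 → ℝ) (u₀ : Literature.MathematicalPhysics.KineticTheory.T3 → Literature.MathematicalPhysics.KineticTheory.V3) (N : ℕ) (Φ : Literature.Analysis.FluidPDE.HardSphereFlow (Literature.Analysis.FluidPDE.Torus.geometry (Fin 3)) (Literature.MathematicalPhysics.KineticTheory.hsDiameter σ N) (N + 1)) (t : ℝ) (π : Equiv.Perm (Fin (N + 1))), 0 < σ → let W : Literature.Analysis.FluidPDE.Config (N + 1) (Fin 3) Literature.MathematicalPhysics.KineticTheory.T3 →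 ℝ := (Literature.Analysis.FluidPDE.hardSphereDomain (Literature.Analysis.FluidPDE.Torus.geometry (Fin 3)) (N + 1) (Literature.MathematicalPhysics.KineticTheory.hsDiameter σ N)).indicator (Literature.Analysis.FluidPDE.hsTransport Φ t (Literature.Analysis.FluidPDE.canonicalDensity (Literature.Analysis.FluidPDE.Torus.geometry (Fin 3)) (Literature.MathematicalPhysics.KineticTheory.hsDiameter σ N) (N + 1) (Literature.MathematicalPhysics.KineticTheory.localGibbsProfile a₀ u₀ θ₀))); Filter.EventuallyEq (MeasureTheory.ae MeasureTheory.volume) (fun z => W (z ∘ π)) W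

/-- item stmt-AtomisticToContinuum-3994 · assembly · rank 1 · closed · moot by None · by planner
sources: Spohn1991, arXiv:1504.03215, PolyanskiyWu2017
[assembly] ContactChaos → CollisionRate → LocalSecondLaw → DensityCap → HydrodynamicLimit
(compactness, free balance, rigidity, flux bookkeeping and complete-Euler weak–strong uniqueness
inside). -/
@[route_item "route-AtomisticToContinuum-InformationPercolation"]
def Assembly : Prop :=
  ContactChaos → CollisionRate → LocalSecondLaw → DensityCap → Literature.MathematicalPhysics.KineticTheory.HydrodynamicLimit

end Summit.AtomisticToContinuum.HydrodynamicLimit.Theses.InformationPercolation
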